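import Literature.NumberTheory.Sieve.ParityBarrierProofs
import HarnessLib

/-!
# Bombieri's asymptotic sieve, vector weights: the algebra of `Λ_(k) = Λ_{k₁} ∗ ⋯ ∗ Λ_{k_r}`

Topic `Literature/NumberTheory/Sieve`, companion ("Proofs") file of
`BombieriAsymptoticSieveVector.lean` ([FriedlanderIwaniecPisa1978] p. 721–722, THEOREM 1
(Bombieri) for a vector `(k) = (k₁, …, k_r)`). Source for the objects: J. Friedlander,
H. Iwaniec, *On Bombieri's asymptotic sieve*, Ann. Scuola Norm. Sup. Pisa Cl. Sci. (4) **5**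
(1978) 719–756, §2 (Lemmata 1–2: `Λ_(k)(n) = 0` for `ω(n) > |k|`, bounds for `Λ_(k)` and for
`𝔏_(k') = Λ_(k') ∗ μ`) and §4, p. 735 (Remark: `Λ_(k) = 𝔏_(k') ∗ L^a` for `(k) = (k', a)`).

Everything here is elementary algebra in Mathlib's Dirichlet ring `ArithmeticFunction ℝ`, for the
list product `(ks.map generalizedVonMangoldt).prod` which is the `Λ_(k)` of the vendored statement
`Bombieri1976_asymptotic_sieve_vector`:

* order lemmas for Dirichlet convolution of nonnegative functions and for `f ↦ f · log`;
* `generalizedVonMangoldt_mul_le` — the POINTWISE DOMINATION `(Λ_j ∗ Λ_K)(n) ≤ 2^j Λ_{j+K}(n)`,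
  by induction on `j` from the recursion `Λ_{j+1} = Λ_j · log + Λ ∗ Λ_j`
  (`generalizedVonMangoldt_succ`) and the Leibniz rule `(f ∗ g) · log = (f · log) ∗ g + f ∗ (g · log)`
  (`pmul_log_mul`), all terms being nonnegative; hence `lambdaVec_le`:
  `Λ_(k)(n) ≤ 2^{|k|} Λ_{|k|}(n)` for every vector `(k)`. This is the device by which the
  `Σ₀`-bound of the vector case ([FriedlanderIwaniecPisa1978] Lemma 10) is read off from the
  scalar one proved in the tree (`FI1978_lemma10_holds`), instead of re-running Bombieri's
  Lemmata 1–2;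
* consequences: `Λ_(k) ≥ 0`, `Λ_(k)(n) = 0` if `ω(n) > |k|` (FI Lemma 1), `Λ_(k)(n) ≤ 2^{|k|}(log n)^{|k|}`,
  and `|𝔏_(k')(d)| ≤ 2^{|k'|} (log d)^{|k'|}` for `𝔏_(k') = Λ_(k') ∗ μ` (the form of FI Lemma 2
  used on p. 738: "`|𝔏(d)| (log n/d)^a ≤ (log x)^{|k'|} (log x/y)^a`", here with the harmless
  constant `2^{|k'|}`);
* `lambdaVec_concat`, `lambdaVec_concat_apply` — `Λ_(k', a) = 𝔏_(k') ∗ L^a`, pointwise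
  `Λ_(k)(n) = ∑_{de = n} 𝔏_(k')(d)(log e)^a` (p. 735, Remark), and permutation invariance.

No definitions are introduced (the objects are written as the list products they are).
-/

noncomputable section

open Finset ArithmeticFunction
-- `open ArithmeticFunction` provides the notation `Λ`; do not open `ArithmeticFunction.vonMangoldt`.
open scoped ArithmeticFunction.Moebius ArithmeticFunction.zeta ArithmeticFunction.omega

namespace Literature.NumberTheory.Sieve

namespace BombieriSieve

/-! ### Order lemmas in the Dirichlet ring of real arithmetic functions -/

/-- Dirichlet convolution of pointwise-nonnegative functions is pointwise nonnegative. [folklore] -/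
theorem mul_apply_nonneg {f g : ArithmeticFunction ℝ} (hf : ∀ n, 0 ≤ f n) (hg : ∀ n, 0 ≤ g n)
    (n : ℕ) : 0 ≤ (f * g) n := by
  rw [mul_apply]
  exact Finset.sum_nonneg fun x _ => mul_nonneg (hf x.1) (hg x.2)

/-- Monotonicity of `g ↦ f ∗ g` for `f ≥ 0`, with a constant: if `g ≤ c h` pointwise then
`f ∗ g ≤ c (f ∗ h)` pointwise. [folklore] -/
theorem mul_apply_le_const_mul {f g h : ArithmeticFunction ℝ} (hf : ∀ n, 0 ≤ f n) (c : ℝ)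
    (hgh : ∀ n, g n ≤ c * h n) (n : ℕ) : (f * g) n ≤ c * (f * h) n := by
  rw [mul_apply, mul_apply, Finset.mul_sum]
  refine Finset.sum_le_sum fun x _ => ?_
  calc f x.1 * g x.2 ≤ f x.1 * (c * h x.2) := mul_le_mul_of_nonneg_left (hgh x.2) (hf x.1)
    _ = c * (f x.1 * h x.2) := by ring

/-- Monotonicity of `g ↦ g ∗ f` for `f ≥ 0`, with a constant. [folklore] -/
theorem mul_apply_le_const_mul_right {f g h : ArithmeticFunction ℝ} (hf : ∀ n, 0 ≤ f n) (c : ℝ)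
    (hgh : ∀ n, g n ≤ c * h n) (n : ℕ) : (g * f) n ≤ c * (h * f) n := by
  rw [mul_comm g f, mul_comm h f]
  exact mul_apply_le_const_mul hf c hgh n

/-- `(f · log)(n) = f(n) log n` is monotone in `f` (`log n ≥ 0`). [folklore] -/
theorem pmul_log_apply_le_const_mul {g h : ArithmeticFunction ℝ} (c : ℝ)
    (hgh : ∀ n, g n ≤ c * h n) (n : ℕ) : (g.pmul log) n ≤ c * (h.pmul log) n := by
  rw [pmul_apply, pmul_apply, log_apply, ← mul_assoc]
  exact mul_le_mul_of_nonneg_right (hgh n) (Real.log_natCast_nonneg n)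

/-- `(f · log)(n) ≥ 0` for `f ≥ 0`. [folklore] -/
theorem pmul_log_apply_nonneg {f : ArithmeticFunction ℝ} (hf : ∀ n, 0 ≤ f n) (n : ℕ) :
    0 ≤ (f.pmul log) n := by
  rw [pmul_apply, log_apply]
  exact mul_nonneg (hf n) (Real.log_natCast_nonneg n)

/-! ### The two halves of the recursion `Λ_{K+1} = Λ_K · log + Λ ∗ Λ_K` as inequalities -/

/-- `Λ_K(n) log n ≤ Λ_{K+1}(n)` (the other summand `Λ ∗ Λ_K` of the recursion is `≥ 0`). [folklore] -/
theorem generalizedVonMangoldt_pmul_log_le (K n : ℕ) :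
    ((generalizedVonMangoldt K).pmul log) n ≤ generalizedVonMangoldt (K + 1) n := by
  rw [generalizedVonMangoldt_succ, ArithmeticFunction.add_apply]
  have h : 0 ≤ (Λ * generalizedVonMangoldt K) n :=
    mul_apply_nonneg (fun _ => vonMangoldt_nonneg) (generalizedVonMangoldt_nonneg K) n
  linarith

/-- `(Λ ∗ Λ_K)(n) ≤ Λ_{K+1}(n)` (the other summand `Λ_K · log` of the recursion is `≥ 0`). [folklore] -/
theorem vonMangoldt_mul_generalizedVonMangoldt_le (K n : ℕ) :
    (Λ * generalizedVonMangoldt K) n ≤ generalizedVonMangoldt (K + 1) n := by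
  rw [generalizedVonMangoldt_succ, ArithmeticFunction.add_apply]
  have h : 0 ≤ ((generalizedVonMangoldt K).pmul log) n :=
    pmul_log_apply_nonneg (generalizedVonMangoldt_nonneg K) n
  linarith

/-! ### Pointwise domination `Λ_j ∗ Λ_K ≤ 2^j Λ_{j+K}` and `Λ_(k) ≤ 2^{|k|} Λ_{|k|}` -/

/-- **Pointwise domination of `Λ_j ∗ Λ_K` by `Λ_{j+K}`**: `(Λ_j ∗ Λ_K)(n) ≤ 2^j Λ_{j+K}(n)` for all
`j, K, n`. Induction on `j`: `Λ_{j+1} ∗ Λ_K = (Λ_j · log) ∗ Λ_K + Λ ∗ (Λ_j ∗ Λ_K)`; by the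
Leibniz rule `(Λ_j · log) ∗ Λ_K = (Λ_j ∗ Λ_K) · log − Λ_j ∗ (Λ_K · log) ≤ (Λ_j ∗ Λ_K) · log ≤
2^j Λ_{j+K} · log ≤ 2^j Λ_{j+K+1}`, and `Λ ∗ (Λ_j ∗ Λ_K) ≤ 2^j Λ ∗ Λ_{j+K} ≤ 2^j Λ_{j+K+1}`,
everything being nonnegative. [folklore] -/
theorem generalizedVonMangoldt_mul_le (j K n : ℕ) :
    (generalizedVonMangoldt j * generalizedVonMangoldt K) n ≤
      2 ^ j * generalizedVonMangoldt (j + K) n := by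
  induction j generalizing n with
  | zero => rw [generalizedVonMangoldt_zero, one_mul, pow_zero, one_mul, zero_add]
  | succ j ih =>
    have hK0 := generalizedVonMangoldt_nonneg K
    have hj0 := generalizedVonMangoldt_nonneg j
    -- the recursion and the Leibniz rule, pointwise at `n`
    have hexp : (generalizedVonMangoldt (j + 1) * generalizedVonMangoldt K) n +
        (generalizedVonMangoldt j * (generalizedVonMangoldt K).pmul log) n =
        ((generalizedVonMangoldt j * generalizedVonMangoldt K).pmul log) n +
          (Λ * (generalizedVonMangoldt j * generalizedVonMangoldt K)) n := by
      have hL := pmul_log_mul (generalizedVonMangoldt j) (generalizedVonMangoldt K)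
      have h1 : generalizedVonMangoldt (j + 1) * generalizedVonMangoldt K +
          generalizedVonMangoldt j * (generalizedVonMangoldt K).pmul log =
          (generalizedVonMangoldt j * generalizedVonMangoldt K).pmul log +
            Λ * (generalizedVonMangoldt j * generalizedVonMangoldt K) := by
        rw [generalizedVonMangoldt_succ, add_mul, mul_assoc, hL]; abel
      have h2 := congrArg (fun F : ArithmeticFunction ℝ => F n) h1
      simpa only [ArithmeticFunction.add_apply] using h2
    -- first summand
    have hA : ((generalizedVonMangoldt j * generalizedVonMangoldt K).pmul log) n ≤
        2 ^ j * generalizedVonMangoldt (j + K + 1) n := by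
      have h4 : ((generalizedVonMangoldt j * generalizedVonMangoldt K).pmul log) n ≤
          2 ^ j * ((generalizedVonMangoldt (j + K)).pmul log) n :=
        pmul_log_apply_le_const_mul (2 ^ j) ih n
      have h5 : ((generalizedVonMangoldt (j + K)).pmul log) n ≤
          generalizedVonMangoldt (j + K + 1) n := generalizedVonMangoldt_pmul_log_le _ n
      have h6 : (0 : ℝ) ≤ 2 ^ j := by positivity
      nlinarith
    have hA' : 0 ≤ (generalizedVonMangoldt j * (generalizedVonMangoldt K).pmul log) n :=
      mul_apply_nonneg hj0 (pmul_log_apply_nonneg hK0) n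
    -- second summand
    have hB : (Λ * (generalizedVonMangoldt j * generalizedVonMangoldt K)) n ≤
        2 ^ j * generalizedVonMangoldt (j + K + 1) n := by
      have h3 : (Λ * (generalizedVonMangoldt j * generalizedVonMangoldt K)) n ≤
          2 ^ j * (Λ * generalizedVonMangoldt (j + K)) n :=
        mul_apply_le_const_mul (fun _ => vonMangoldt_nonneg) (2 ^ j) ih n
      have h4 := vonMangoldt_mul_generalizedVonMangoldt_le (j + K) n
      have h6 : (0 : ℝ) ≤ 2 ^ j := by positivity
      nlinarith
    rw [show j + 1 + K = j + K + 1 by omega, pow_succ]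
    linarith

/-- `Λ_(k) ≥ 0` pointwise, for every vector `(k)` (product of nonnegative functions). [folklore] -/
theorem lambdaVec_nonneg (ks : List ℕ) (n : ℕ) : 0 ≤ (ks.map generalizedVonMangoldt).prod n := by
  induction ks generalizing n with
  | nil =>
    rw [List.map_nil, List.prod_nil, one_apply]
    split_ifs <;> norm_num
  | cons k ks ih =>
    rw [List.map_cons, List.prod_cons]
    exact mul_apply_nonneg (generalizedVonMangoldt_nonneg k) ih n

/-- **Pointwise domination of the vector weight by the scalar one**: for every vector
`(k) = (k₁, …, k_r)` and every `n`, `Λ_(k)(n) ≤ 2^{|k|} Λ_{|k|}(n)`, `|k| = k₁ + ⋯ + k_r`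
(iterate `generalizedVonMangoldt_mul_le`). [folklore] -/
theorem lambdaVec_le (ks : List ℕ) (n : ℕ) :
    (ks.map generalizedVonMangoldt).prod n ≤ 2 ^ ks.sum * generalizedVonMangoldt ks.sum n := by
  induction ks generalizing n with
  | nil => rw [List.map_nil, List.prod_nil, List.sum_nil, generalizedVonMangoldt_zero, pow_zero, one_mul]
  | cons k ks ih =>
    rw [List.map_cons, List.prod_cons, List.sum_cons]
    calc (generalizedVonMangoldt k * (ks.map generalizedVonMangoldt).prod) n
        ≤ 2 ^ ks.sum * (generalizedVonMangoldt k * generalizedVonMangoldt ks.sum) n :=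
          mul_apply_le_const_mul (generalizedVonMangoldt_nonneg k) _ ih n
      _ ≤ 2 ^ ks.sum * (2 ^ k * generalizedVonMangoldt (k + ks.sum) n) :=
          mul_le_mul_of_nonneg_left (generalizedVonMangoldt_mul_le k ks.sum n) (by positivity)
      _ = 2 ^ (k + ks.sum) * generalizedVonMangoldt (k + ks.sum) n := by rw [pow_add]; ring

/-- **[FriedlanderIwaniecPisa1978] Lemma 1**: `Λ_(k)(n) = 0` whenever `ω(n) > |k|` (from the
domination and the support of `Λ_{|k|}`, `generalizedVonMangoldt_eq_zero_of_lt_card_primeFactors`).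
[cite: FriedlanderIwaniecPisa1978, Lemma 1] -/
theorem lambdaVec_eq_zero_of_lt_card_primeFactors {ks : List ℕ} {n : ℕ}
    (h : ks.sum < n.primeFactors.card) : (ks.map generalizedVonMangoldt).prod n = 0 := by
  refine le_antisymm ?_ (lambdaVec_nonneg ks n)
  have := lambdaVec_le ks n
  rwa [generalizedVonMangoldt_eq_zero_of_lt_card_primeFactors h, mul_zero] at this

/-- `Λ_(k)(n) ≤ 2^{|k|} (log n)^{|k|}` for `|k| ≥ 1` (domination and `Λ_K ≤ log^K`). [folklore] -/
theorem lambdaVec_le_pow_log {ks : List ℕ} (hks : 0 < ks.sum) (n : ℕ) :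
    (ks.map generalizedVonMangoldt).prod n ≤ 2 ^ ks.sum * Real.log n ^ ks.sum :=
  (lambdaVec_le ks n).trans
    (mul_le_mul_of_nonneg_left (generalizedVonMangoldt_le hks n) (by positivity))

/-- `Λ_(k)(n) = 0` unless `n ≥ 2`, when `|k| ≥ 1`. [folklore] -/
theorem lambdaVec_eq_zero_of_le_one {ks : List ℕ} (hks : 0 < ks.sum) {n : ℕ} (hn : n ≤ 1) :
    (ks.map generalizedVonMangoldt).prod n = 0 := by
  refine le_antisymm ?_ (lambdaVec_nonneg ks n)
  have := lambdaVec_le ks n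
  rwa [generalizedVonMangoldt_eq_zero_of_le_one hks hn, mul_zero] at this

/-! ### `𝔏_(k') = Λ_(k') ∗ μ` and the representation `Λ_(k', a) = 𝔏_(k') ∗ L^a` -/

/-- `∑_{d ∣ n} Λ_K(d) = (log n)^K` for all `K` and `n ≠ 0` (for `K = 0` both sides are `1`). [folklore] -/
theorem coe_zeta_mul_generalizedVonMangoldt_apply (K : ℕ) {n : ℕ} (hn : n ≠ 0) :
    ((ζ : ArithmeticFunction ℝ) * generalizedVonMangoldt K) n = Real.log n ^ K := by
  rw [coe_zeta_mul_generalizedVonMangoldt]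
  rcases Nat.eq_zero_or_pos K with rfl | hK
  · rw [ppow_zero, natCoe_apply, zeta_apply, if_neg hn, Nat.cast_one, pow_zero]
  · rw [ppow_apply hK, log_apply]

/-- For `f ≥ 0`: `|(f ∗ μ)(n)| ≤ (ζ ∗ f)(n) = ∑_{d ∣ n} f(d)` (`|μ| ≤ 1`). [folklore] -/
theorem abs_mul_moebius_apply_le {f : ArithmeticFunction ℝ} (hf : ∀ n, 0 ≤ f n) (n : ℕ) :
    |(f * (μ : ArithmeticFunction ℝ)) n| ≤ ((ζ : ArithmeticFunction ℝ) * f) n := by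
  rw [mul_apply, coe_zeta_mul_apply, ← Nat.map_div_right_divisors,
    Finset.sum_map]
  refine (Finset.abs_sum_le_sum_abs _ _).trans (Finset.sum_le_sum fun d hd => ?_)
  simp only [Function.Embedding.coeFn_mk, intCoe_apply]
  have hμ : |(μ (n / d) : ℝ)| ≤ 1 := by
    rw [← Int.cast_abs]
    exact_mod_cast ArithmeticFunction.abs_moebius_le_one
  rw [abs_mul, abs_of_nonneg (hf d)]
  exact (mul_le_mul_of_nonneg_left hμ (hf d)).trans_eq (mul_one _)

/-- **The coefficient bound** ([FriedlanderIwaniecPisa1978] Lemma 2 in the form used on p. 738):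
for `𝔏_(k') = Λ_(k') ∗ μ` and `d ≥ 1`, `|𝔏_(k')(d)| ≤ 2^{|k'|} (log d)^{|k'|}` (so `≤ 2^{|k'|}(log x)^{|k'|}`
for `d ≤ x`; for `|k'| = 0`, `𝔏 = μ` and the bound is `1`). [cite: FriedlanderIwaniecPisa1978, Lemma 2] -/
theorem abs_lambdaVec_mul_moebius_le (ks : List ℕ) {d : ℕ} (hd : d ≠ 0) :
    |((ks.map generalizedVonMangoldt).prod * (μ : ArithmeticFunction ℝ)) d| ≤
      2 ^ ks.sum * Real.log d ^ ks.sum := by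
  refine (abs_mul_moebius_apply_le (lambdaVec_nonneg ks) d).trans ?_
  calc ((ζ : ArithmeticFunction ℝ) * (ks.map generalizedVonMangoldt).prod) d
      ≤ 2 ^ ks.sum * ((ζ : ArithmeticFunction ℝ) * generalizedVonMangoldt ks.sum) d :=
        mul_apply_le_const_mul (fun m => by
          rw [natCoe_apply, zeta_apply]; split_ifs <;> norm_num) _ (lambdaVec_le ks) d
    _ = 2 ^ ks.sum * Real.log d ^ ks.sum := by rw [coe_zeta_mul_generalizedVonMangoldt_apply _ hd]

/-- The coefficient bound, uniform on `1 ≤ d ≤ x`: `|𝔏_(k')(d)| ≤ 2^{|k'|} (log x)^{|k'|}`. [folklore] -/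
theorem abs_lambdaVec_mul_moebius_le_of_le (ks : List ℕ) {d : ℕ} (hd : 1 ≤ d) {x : ℝ}
    (hdx : (d : ℝ) ≤ x) :
    |((ks.map generalizedVonMangoldt).prod * (μ : ArithmeticFunction ℝ)) d| ≤
      2 ^ ks.sum * Real.log x ^ ks.sum := by
  have hd1 : (1 : ℝ) ≤ d := by exact_mod_cast hd
  refine (abs_lambdaVec_mul_moebius_le ks (by omega)).trans ?_
  exact mul_le_mul_of_nonneg_left (pow_le_pow_left₀ (Real.log_nonneg hd1)
    (Real.log_le_log (by linarith) hdx) _) (by positivity)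

/-- **`Λ_(k', a) = 𝔏_(k') ∗ L^a`** ([FriedlanderIwaniecPisa1978] p. 735, Remark): for the list
`ks ++ [a]`, `Λ_(ks, a) = (Λ_(ks) ∗ μ) ∗ log^a` in the Dirichlet ring (`Λ_a = μ ∗ log^a` by
definition). [cite: FriedlanderIwaniecPisa1978, p. 735 (Remark)] -/
theorem lambdaVec_concat (ks : List ℕ) (a : ℕ) :
    ((ks ++ [a]).map generalizedVonMangoldt).prod =
      ((ks.map generalizedVonMangoldt).prod * (μ : ArithmeticFunction ℝ)) * log.ppow a := by
  rw [List.map_append, List.prod_append, List.map_singleton, List.prod_singleton,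
    generalizedVonMangoldt, mul_assoc]

/-- Pointwise form: `Λ_(k', a)(n) = ∑_{de = n} 𝔏_(k')(d) (log e)^a` for `a ≥ 1`. [folklore] -/
theorem lambdaVec_concat_apply (ks : List ℕ) {a : ℕ} (ha : 0 < a) (n : ℕ) :
    ((ks ++ [a]).map generalizedVonMangoldt).prod n =
      ∑ x ∈ n.divisorsAntidiagonal,
        ((ks.map generalizedVonMangoldt).prod * (μ : ArithmeticFunction ℝ)) x.1 *
          Real.log x.2 ^ a := by
  rw [lambdaVec_concat, mul_apply]
  exact Finset.sum_congr rfl fun x _ => by rw [ppow_apply ha, log_apply]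

/-- Permutation invariance: `Λ_(k)` depends only on the multiset of ranks. [folklore] -/
theorem lambdaVec_perm {ks ks' : List ℕ} (h : ks.Perm ks') :
    (ks.map generalizedVonMangoldt).prod = (ks'.map generalizedVonMangoldt).prod :=
  (h.map _).prod_eq

/-- Zeros may be dropped: `Λ_(0, k) = Λ_(k)` (`Λ₀ = δ`). [folklore] -/
theorem lambdaVec_cons_zero (ks : List ℕ) :
    ((0 :: ks).map generalizedVonMangoldt).prod = (ks.map generalizedVonMangoldt).prod := by
  rw [List.map_cons, List.prod_cons, generalizedVonMangoldt_zero, one_mul]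

end BombieriSieve

end Literature.NumberTheory.Sieve

end
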